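import Summits.FinalStateConjecture.FinalStateConjecture.Theorems.EIHFluxBalanceInertialRecessionChargeKinematicsClusterAlgebra

/-!
# Route EIHFluxBalance — `InertialRecession`, line `old-light-leaves-the-cone`: charge kinematics, XXII-b (general N: first hits, breakpoints, telescoping)
Helper file for the crux `stmt-FinalStateConjecture-10166`, second line lead, endgame stub
`stub_expandingChargeKinematics` (S4) FOR GENERAL `N`. First hit of a level by a finite family (`exists_first_hit_family`), breakpoint enumerations of finite sets of times
(`exists_breakpoint_enumeration`) and telescoping over consecutive pieces (`norm_sub_le_sum_pieces`).
Mathlib-only real analysis over the stub's verbatim hypotheses ([folklore]); the abstract charge `P` is adversarial.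
-/
set_option linter.dupNamespace false

noncomputable section

open Filter Set Metric Real
open scoped Topology

namespace Summit.FinalStateConjecture.FinalStateConjecture.Theorems.ChargeKinematics

open Literature.Geometry.Lorentzian

/-! ## First hit by a finite family -/

section FirstHitFamily

open MeasureTheory intervalIntegral

/-- **First hit by a finite family.** For finitely many continuous functions, all `< a` at `t₀`, if one of
them reaches `a` at some `s₁ ≥ t₀` then there is a least time `τ ∈ (t₀, s₁]` at which some member equals
`a`, with every member `≤ a` on `[t₀, τ]` (first exit of the finite maximum). [folklore] -/
theorem exists_first_hit_family {ι : Type*} (S : Finset ι) (hS : S.Nonempty) {f : ι → ℝ → ℝ}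
    {t₀ s₁ a : ℝ} (hf : ∀ j ∈ S, Continuous (f j)) (h0 : ∀ j ∈ S, f j t₀ < a) (hs₁ : t₀ ≤ s₁)
    (ha : ∃ j ∈ S, a ≤ f j s₁) :
    ∃ τ, t₀ < τ ∧ τ ≤ s₁ ∧ (∃ j ∈ S, f j τ = a) ∧ ∀ j ∈ S, ∀ s ∈ Set.Icc t₀ τ, f j s ≤ a := by
  classical
  set F : ℝ → ℝ := fun s ↦ S.sup' hS fun j ↦ f j s with hFdef
  have hFc : Continuous F := Continuous.finset_sup'_apply hS fun j hj ↦ hf j hj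
  have hF0 : F t₀ < a := by
    simp only [hFdef]
    exact (Finset.sup'_lt_iff hS).mpr fun j hj ↦ h0 j hj
  have hFa : a ≤ F s₁ := by
    obtain ⟨j, hj, hja⟩ := ha
    exact hja.trans (Finset.le_sup' (fun j ↦ f j s₁) hj)
  obtain ⟨τ, ht₀τ, hτs₁, hτeq, hτle⟩ := exists_first_exit (f := F) (a := a) hFc hF0 hs₁ hFa
  refine ⟨τ, ht₀τ, hτs₁, ?_, fun j hj s hs ↦ (Finset.le_sup' (fun j ↦ f j s) hj).trans (hτle s hs)⟩
  obtain ⟨j, hj, hjeq⟩ := Finset.exists_mem_eq_sup' hS (fun j ↦ f j τ)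
  exact ⟨j, hj, by rw [← hjeq]; exact hτeq⟩

end FirstHitFamily

/-! ## Breakpoints and telescoping -/

section Breakpoints

open MeasureTheory intervalIntegral

/-- **Telescoping of increments along a monotone finite sequence of times.** [folklore] -/
theorem norm_sub_le_sum_pieces {E : Type*} [SeminormedAddCommGroup E] (w : ℝ → E) {n : ℕ} (σ : ℕ → ℝ) :
    ‖w (σ n) - w (σ 0)‖ ≤ ∑ i ∈ Finset.range n, ‖w (σ (i + 1)) - w (σ i)‖ := by
  induction n with
  | zero => simp
  | succ n ih =>
    rw [Finset.sum_range_succ]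
    calc ‖w (σ (n + 1)) - w (σ 0)‖ = ‖(w (σ (n + 1)) - w (σ n)) + (w (σ n) - w (σ 0))‖ := by
          rw [sub_add_sub_cancel]
      _ ≤ ‖w (σ (n + 1)) - w (σ n)‖ + ‖w (σ n) - w (σ 0)‖ := norm_add_le _ _
      _ ≤ _ := by linarith

/-- **Partition of an interval by a finite set of breakpoints.** A finite set `B` of reals containing `t₁`
and `t₂` and contained in `[t₁, t₂]` is enumerated increasingly by `σ 0 = t₁, …, σ n = t₂`
(`n + 1 = B.card`) with no breakpoint strictly inside a piece; consequently every interval `[α, ω]` with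
endpoints in `B` either contains a piece or meets its interior trivially. [folklore] -/
theorem exists_breakpoint_enumeration (B : Finset ℝ) {t₁ t₂ : ℝ} (h₁ : t₁ ∈ B) (h₂ : t₂ ∈ B)
    (hB : ∀ b ∈ B, t₁ ≤ b ∧ b ≤ t₂) :
    ∃ (n : ℕ) (σ : ℕ → ℝ), n + 1 = B.card ∧ σ 0 = t₁ ∧ σ n = t₂ ∧ (∀ i, i < n → σ i ≤ σ (i + 1)) ∧
      (∀ i, i ≤ n → σ i ∈ B) ∧ (∀ i, i < n → ∀ b ∈ B, b ≤ σ i ∨ σ (i + 1) ≤ b) ∧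
      (∀ i, i < n → ∀ α ∈ B, ∀ ω ∈ B, (α ≤ σ i ∧ σ (i + 1) ≤ ω) ∨ σ (i + 1) ≤ α ∨ ω ≤ σ i) := by
  classical
  have hcard : 0 < B.card := Finset.card_pos.mpr ⟨t₁, h₁⟩
  set k := B.card with hk
  -- the increasing enumeration
  let emb : Fin k ↪o ℝ := B.orderEmbOfFin rfl
  have hmemB : ∀ i : Fin k, emb i ∈ B := fun i ↦ Finset.orderEmbOfFin_mem B rfl i
  have hsurj : ∀ b ∈ B, ∃ i : Fin k, emb i = b := fun b hb ↦ by
    have : b ∈ Set.range emb := by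
      rw [Finset.range_orderEmbOfFin]; exact hb
    exact this
  -- extend to ℕ by clamping the index
  set n := k - 1 with hn
  have hnk : n + 1 = k := by omega
  let σ : ℕ → ℝ := fun i ↦ emb ⟨min i n, by omega⟩
  have hσ : ∀ i (hi : i ≤ n), σ i = emb ⟨i, by omega⟩ := fun i hi ↦ by
    simp only [σ, min_eq_left hi]
  have hmono : ∀ i j : ℕ, i ≤ j → j ≤ n → σ i ≤ σ j := fun i j hij hj ↦ by
    rw [hσ i (hij.trans hj), hσ j hj]
    exact emb.monotone (Fin.mk_le_mk.mpr hij)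
  -- the least and the largest element are `t₁` and `t₂`
  have hσ0 : σ 0 = t₁ := by
    apply le_antisymm
    · obtain ⟨i, hi⟩ := hsurj t₁ h₁
      have : σ 0 ≤ emb i := by
        rw [hσ 0 (Nat.zero_le _)]; exact emb.monotone (Fin.mk_le_mk.mpr (Nat.zero_le _))
      rw [hi] at this; exact this
    · exact (hB _ (by rw [hσ 0 (Nat.zero_le _)]; exact hmemB _)).1
  have hσn : σ n = t₂ := by
    apply le_antisymm
    · exact (hB _ (by rw [hσ n le_rfl]; exact hmemB _)).2
    · obtain ⟨i, hi⟩ := hsurj t₂ h₂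
      have : emb i ≤ σ n := by
        rw [hσ n le_rfl]; exact emb.monotone (Fin.mk_le_mk.mpr (by omega))
      rw [hi] at this; exact this
  -- no breakpoint strictly inside a piece
  have hgap : ∀ i, i < n → ∀ b ∈ B, b ≤ σ i ∨ σ (i + 1) ≤ b := by
    intro i hi b hb
    obtain ⟨j, hj⟩ := hsurj b hb
    rcases le_or_gt (j : ℕ) i with hle | hlt
    · left
      rw [← hj, hσ i hi.le]
      exact emb.monotone (Fin.mk_le_mk.mpr hle)
    · right
      rw [← hj, hσ (i + 1) (by omega)]
      exact emb.monotone (Fin.mk_le_mk.mpr (by omega))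
  refine ⟨n, σ, hnk, hσ0, hσn, fun i hi ↦ hmono i (i + 1) (Nat.le_succ i) (by omega),
    fun i hi ↦ by rw [hσ i hi]; exact hmemB _, hgap, fun i hi α hα ω hω ↦ ?_⟩
  rcases hgap i hi α hα with hα' | hα'
  · rcases hgap i hi ω hω with hω' | hω'
    · exact Or.inr (Or.inr hω')
    · exact Or.inl ⟨hα', hω'⟩
  · exact Or.inr (Or.inl hα')

end Breakpoints

end Summit.FinalStateConjecture.FinalStateConjecture.Theorems.ChargeKinematics

namespace Summit.FinalStateConjecture.FinalStateConjecture.Theorems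

/-- REGISTERED STUB `exists_breakpoint_enumeration` of the crux item stmt-FinalStateConjecture-10166 (second line lead, line
`old-light-leaves-the-cone`, S4): the registered signature verbatim, by `ChargeKinematics.exists_breakpoint_enumeration`. [folklore] -/
theorem exists_breakpoint_enumeration : open Literature.Geometry.Lorentzian Filter Topology MeasureTheory intervalIntegral in ∀ (B : Finset ℝ) {t₁ t₂ : ℝ} (h₁ : t₁ ∈ B) (h₂ : t₂ ∈ B) (hB : ∀ b ∈ B, t₁ ≤ b ∧ b ≤ t₂), ∃ (n : ℕ) (σ : ℕ → ℝ), n + 1 = B.card ∧ σ 0 = t₁ ∧ σ n = t₂ ∧ (∀ i, i < n → σ i ≤ σ (i + 1)) ∧ (∀ i, i ≤ n → σ i ∈ B) ∧ (∀ i, i < n → ∀ b ∈ B, b ≤ σ i ∨ σ (i + 1) ≤ b) ∧ (∀ i, i < n → ∀ α ∈ B, ∀ ω ∈ B, (α ≤ σ i ∧ σ (i + 1) ≤ ω) ∨ σ (i + 1) ≤ α ∨ ω ≤ σ i) :=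
  @ChargeKinematics.exists_breakpoint_enumeration

end Summit.FinalStateConjecture.FinalStateConjecture.Theorems

end
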